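/-
Copyright (c) 2026 the pub-hodgecm-mathlib formalisation cell (harness21).  Prover seat hodgecm-mathlib-K2Liu-p05 (g5), Track B «K2-LIT»,
#184♮ = hLiu418 = `stmt-HodgeConjecture-24832`; #42S payer road, organ S2 (archimedean spanning), file S2-J part J2c
(LEAD F0P6-plan (g14) BATCH #20 (1) «J2c = assembly on ★ exists_clm_swSection_tmul_mul_archEmb_placeSecJ + ★ archSectionRepJ_placeSecJ_inl_tensorPi + (b1)(b2) +
p16's (J2⊗-arch)»; (J2⊗-arch) group identity BY VALUE — K2E5-p16 (g6) FILE 2).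
-/
import Summits.HodgeConjecture.HodgeConjecture.Theorems.K2LiuSwSectionPlaceSmooth        -- ★ (W4) `exists_clm_swSection_tmul_mul_archEmb_placeSecJ` (+ `placeSecJ`, `archSectionRepJ`, `archEmb`)
import Summits.HodgeConjecture.HodgeConjecture.Theorems.K2LiuArchSectionPlacePinned      -- ★ `archSectionRepJ_placeSecJ_inl_tensorPi` (χ pinned)
import Summits.HodgeConjecture.HodgeConjecture.Theorems.K2LiuWeilSeesawRelabel           -- (J2⊗-KK) `weilRepPair_unit_toBig_inl`
import Literature.NumberTheory.K2Lit.SiegelWeilSectionTensor                              -- ★ `swSectionTensor`, `swSectionTensor_apply`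
import HarnessLib

/-!
# Crux `HLiu418`, #42S organ S2, file S2-J part J2c: THE SIEGEL–WEIL SECTION OF `𝔻 ⊗ V′` ALONG A ONE-PLACE SUBGROUP OF THE SMALL GROUP READS THE
# JUNCTION WEIL REPRESENTATION OF THE PAIR `U(𝔻_σ) × U(V′_σ)` — `f_{a ⊗ f}(H · k_h) = η · ℓ′((e_* ω_{P,Q,R,S}(h,1) Φ₁) ⊠ Φ₂)`

Cell `hodgecm-mathlib`, crux item hLiu418 = `stmt-HodgeConjecture-24832`; squad K2 ∕ K2Liu; LEAD F0P6-plan (g14); prover K2Liu-p05 (g5).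
THEOREMS ONLY (no `def`, no instance, no notation, no named-fact hypothesis, no `sorry`); lane `--supports stmt-HodgeConjecture-24832 --as helper`.

WHY.  The arch organ S2 computes the archimedean Weil action in Konno–Konno's JUNCTION model of the pair `U(𝔻_σ) × U(V′_σ) = U(P,Q) × U(R,S)` (`U(2,2) × U(p′,q′)`)
(★ `K2LiuArchWeilFockDerivatives`, ★ `K2LiuWeilDatum*U22`); socket #42S reads it through the Siegel–Weil sections ★ `swSectionTensor sB Φ h` of the BIG datum
`𝔻 ⊗ V′`, i.e. through Folland's section of the big arch group `U(𝕎_∞)` (★ `K2LiuDoubledWeilRepArchPinned`).  The (W4) files of the G2-Weil lineage (★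
`K2LiuArchSectionPlace{Block,Junction,Pinned}`, ★ `K2LiuSwSectionPlaceSmooth`) — GENERIC in the unitary group — already give, at the big datum and one real place `σ`:
`swSection sB (E(a ⊗ f)) (H′ · archEmb (placeSecJ σ u)) = η_t(placeSecJ σ u) · ℓ′(archSectionRepJ σ (placeSecJ σ u) (𝒥 a))` (ONE continuous linear `ℓ′`) and
`archSectionRepJ σ (placeSecJ σ (g,1)) (Φ₁ ⊠ Φ₂) = (ω_{(P′,Q′),(1,∅)} (g,1) Φ₁) ⊠ Φ₂` (the junction of `U(𝕎_σ) × U(1,0)`, χ PINNED).  With the block types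
`P′ := (P×R) ⊕ (Q×S)`, `Q′ := (P×S) ⊕ (Q×R)` (Konno–Konno's sorted index of `𝕎_σ = 𝔻_σ ⊗ V′_σ`, bijections `eP`, `eQ` from the sign frame of `𝕎_σ` — ★ J0
`K2LiuArchTensorSign*`, K2E5-p16) the element `h ⊗ 1_{V′}` is `toBig P Q R S (h, 1) ∈ U(P′,Q′)` and the SEE-SAW (★∕📤 `K2LiuWeilSeesawRelabel.weilRepPair_unit_toBig_inl`)
turns `ω_{(P′,Q′),(1,∅)} (h ⊗ 1, 1)` on a relabelled vector `e_* Φ₁` into `e_* (ω_{(P,Q),(R,S)} (h, 1) Φ₁)`.  This file composes the three: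
* **`exists_clm_swSectionTensor_mul_oneplace_eq`** — for a `χ`-normalised `sB` on `𝔻 ⊗ V′`, a finite vector `f`, `H ∈ H(𝔸)` and ANY one-place homomorphism
  `ψ : U(P,Q) →* H(L⁺ ⊗ ℝ)` of the SMALL group whose tensor image is the big one-place section at `h ⊗ 1` (hypothesis `hsec`, the (J2⊗-arch) group identity
  `tensorEmb (archEmb (ψ h)) = archEmb (placeSecJ_𝕎 σ (toBig P Q R S (h,1), 1))`, K2E5-p16 FILE 2 with `ψ := placeSec_𝔻 σ`): there is ONE continuous linear
  functional `ℓ′` on the junction-frame Schwartz space with, for all `h`, `Φ₁ ∈ 𝓢(ℝ^{DPIdx P Q R S})`, `Φ₂`, and `a` with `𝒥 a = (e_* Φ₁) ⊠ Φ₂`: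
  **`swSectionTensor sB (E(a ⊗ f)) (H · archEmb (ψ h)) = η_t(placeSecJ_𝕎 σ (h ⊗ 1, 1)) · ℓ′ ((e_* (ω_{(P,Q),(R,S)} (h, 1) Φ₁)) ⊠ Φ₂)`** — the (W-T) letter of the S2
  organ in the junction of the PAIR, by name.
NOT HERE: the (J2⊗-arch) identity itself (K2E5-p16); the derivative form (★ `hasDerivAt_swSection_tmul_placeSecJ_expMem` at the big datum + this file, S2-W (r-b),
K2Liu-p14); the iteration over places ((V-inst), ★ `K2LiuPureTensorFactorwiseFunctional`).
References: [KonnoKonno2007] §3.1 (3.1), §3.3 p. 47, Lemma 5.2; [Kudla1984] §1; [Folland1989] Prop. (1.43), §4.2 (4.23), Prop. (4.39); [Weil1964] Chap. I n° 12,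
Chap. III n° 37–39; [KudlaRallis1994] §1; [GelbartRogawski1991] §3.1 Prop. 3.1.1; [Paul1998] §1.2.
HONEST LABEL.  Count-neutral helper: `HC_CM` is proved only modulo the 7 printed citations (2 remaining named inputs: hLiu418 = `stmt-HodgeConjecture-24832`,
h413 = `stmt-HodgeConjecture-24833`) until rung 0 closes.
-/

set_option autoImplicit false
set_option linter.dupNamespace false -- the mandated namespace repeats `HodgeConjecture.HodgeConjecture`
set_option synthInstance.maxSize 512 -- `DecidableEq` of the nested block index (as ★∕📤 `K2LiuWeilSeesawRelabel`)

noncomputable section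

open scoped Classical Matrix TensorProduct Kronecker SchwartzMap
open NumberField NumberField.InfinitePlace NumberField.mixedEmbedding IsDedekindDomain
open Literature.Analysis.SegalBargmann Literature.RepresentationTheory.HeisenbergGroup
open Literature.NumberTheory.Automorphic Literature.NumberTheory.Automorphic.UnitaryGroup Literature.NumberTheory.GaloisRepresentations
open Literature.NumberTheory.Weil1964 Literature.NumberTheory.Weil1964.MpS Literature.NumberTheory.Weil1964.UnitaryWeil
open Literature.RepresentationTheory.HarrisKudlaSweet1996
open Literature.RepresentationTheory.KonnoKonno2007 Literature.RepresentationTheory.KonnoKonno2007.RealDualPair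
open Literature.NumberTheory.GelbartRogawski1991 Literature.NumberTheory.GelbartRogawski1991.GRConstruction
open Literature.NumberTheory.GelbartRogawski1991.UnitaryDualPair
open Literature.NumberTheory.GelbartRogawski1991.UnitaryDualPair.LocalSplitting
open Literature.NumberTheory.K2Lit.SiegelDoubled
open Summit.HodgeConjecture.HodgeConjecture.Cruxes.HLiu418.K2LiuArchSectionPlaceBlock
open Summit.HodgeConjecture.HodgeConjecture.Cruxes.HLiu418 (K2LiuArchOneParameterOrbitDefs.archEmb)
open Summit.HodgeConjecture.HodgeConjecture.Cruxes.HLiu418.K2LiuSwSectionArchOrbit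
open Summit.HodgeConjecture.HodgeConjecture.Cruxes.HLiu418.K2LiuWeilSeesawRelabel

namespace Summit.HodgeConjecture.HodgeConjecture.Cruxes.HLiu418.K2LiuArchWeilJunctionTransport

variable (L : Type) [Field L] [NumberField L] [IsCMField L]
variable {N M n : ℕ} (e : Fin N × Fin M ≃ Fin n)
  (dV : Fin N → L) (hdV : ∀ i, IsCMField.complexConj L (dV i) = dV i) (hdV0 : ∀ i, dV i ≠ 0)
  (dW : Fin M → L) (hdW : ∀ i, IsCMField.complexConj L (dW i) = dW i) (hdW0 : ∀ i, dW i ≠ 0)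
variable {M₂ M' n' : ℕ} (eW : Fin M × Fin M₂ ≃ Fin M') (e' : Fin N × Fin M' ≃ Fin n')
  (dV' : Fin M₂ → L) (hdV' : ∀ k, IsCMField.complexConj L (dV' k) = dV' k) (hdV'0 : ∀ k, dV' k ≠ 0)
variable (σ : {v : InfinitePlace (Fp L) // v.IsReal})
  {P Q R S : Type} [Fintype P] [DecidableEq P] [Fintype Q] [DecidableEq Q] [Fintype R] [DecidableEq R] [Fintype S] [DecidableEq S]
  (eP : PosIdx (signVec (cmPlaceOver L) (fun k => Sum.elim (cmGramEntry L e' dV hdV (tensorFrame L dW eW dV') (tensorFrame_real L dW hdW eW dV' hdV')) (-cmGramEntry L e' dV hdV (tensorFrame L dW eW dV') (tensorFrame_real L dW hdW eW dV' hdV')) ((LocalSplitting.e₂ n').symm k)) (imagUnit L) σ) ≃ (P × R) ⊕ (Q × S))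
  (eQ : NegIdx (signVec (cmPlaceOver L) (fun k => Sum.elim (cmGramEntry L e' dV hdV (tensorFrame L dW eW dV') (tensorFrame_real L dW hdW eW dV' hdV')) (-cmGramEntry L e' dV hdV (tensorFrame L dW eW dV') (tensorFrame_real L dW hdW eW dV' hdV')) ((LocalSplitting.e₂ n').symm k)) (imagUnit L) σ) ≃ (P × S) ⊕ (Q × R))

-- the doubled metaplectic carrier of the big datum and the CM sign frame elaborate slowly (as ★ `K2LiuSwSectionPlaceSmooth`: 2 000 000 heartbeats)
set_option maxHeartbeats 4000000

include hdW0 in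
/-- **THE SIEGEL–WEIL SECTION OF `𝔻 ⊗ V′` ALONG A ONE-PLACE SUBGROUP OF THE SMALL GROUP, IN THE JUNCTION OF THE PAIR `U(𝔻_σ) × U(V′_σ)`.**
For a `χ`-normalised doubled Weil representation `sB` of the big datum (`χ` unitary splitting of odd unitary archimedean type `t`), a finite vector `f`, `H ∈ H(𝔸)`,
and a homomorphism `ψ : U(P,Q) →* H(L⁺ ⊗ ℝ)` with `tensorEmb (archEmb (ψ h)) = archEmb (placeSecJ_𝕎 σ (toBig P Q R S (h,1), 1))` (the (J2⊗-arch) identity, by value):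
there is ONE continuous linear functional `ℓ′` on `𝓢(ℝ^{DPIdx P′ Q′ 1 ∅ ⊕ (Fin (n′+n′) × {v ≠ σ})})` such that for all `h`, `Φ₁`, `Φ₂` and `a` with `𝒥 a = (e_* Φ₁) ⊠ Φ₂`:
`swSectionTensor sB (E(a ⊗ f)) (H · archEmb (ψ h)) = η_t(placeSecJ_𝕎 σ (h ⊗ 1, 1)) · ℓ′ ((e_* ((weilRep ∘ toBig P Q R S) (h, 1) Φ₁)) ⊠ Φ₂)` — ★ (W4)
`exists_clm_swSection_tmul_mul_archEmb_placeSecJ` + ★ `archSectionRepJ_placeSecJ_inl_tensorPi` at the big datum + the see-saw `weilRepPair_unit_toBig_inl`.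
[cite: KonnoKonno2007, §3.3 p. 47, Lemma 5.2] [cite: Folland1989, Prop. (1.43), §4.2 (4.23)] [cite: Kudla1984, §1] [cite: KudlaRallis1994, §1] [cite: Weil1964, Chap. III n° 37–39] -/
theorem exists_clm_swSectionTensor_mul_oneplace_eq {χ : HeckeCharacter L} (hχu : χ.IsUnitary) (hχs : IsSplittingChar L 1 χ)
    {sB : HA L e' dV hdV (tensorFrame L dW eW dV') (tensorFrame_real L dW hdW eW dV' hdV') →*
      MpD L e' dV hdV (tensorFrame L dW eW dV') (tensorFrame_real L dW hdW eW dV' hdV')}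
    (hsB : IsDoubledWeilRep L e' dV hdV hdV0 (tensorFrame L dW eW dV') (tensorFrame_real L dW hdW eW dV' hdV')
      (tensorFrame_ne_zero L dW eW dV' hdW0 hdV'0) χ sB)
    {t : InfinitePlace L → ℤ} (ht : χ.HasUnitaryArchType t 0) (hodd : ∀ w, Odd (t w))
    (H : HA L e dV hdV dW hdW) (f : FinSB (Fp L) (Fin (n' + n')))
    (ψ : UForm P Q →* UnitaryGroup.arch (Fp L) L (IsCMField.complexConj L) (n + n) (hermD L e dV hdV dW hdW))
    (hsec : ∀ h : UForm P Q,
      tensorEmb L e dV hdV dW hdW eW e' dV' hdV' (K2LiuArchOneParameterOrbitDefs.archEmb (Fp L) L (IsCMField.complexConj L) (n + n) (hermD L e dV hdV dW hdW) (ψ h)) =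
        K2LiuArchOneParameterOrbitDefs.archEmb (Fp L) L (IsCMField.complexConj L) (n' + n') (hermD L e' dV hdV (tensorFrame L dW eW dV') (tensorFrame_real L dW hdW eW dV' hdV'))
          (placeSecJ L (IsCMField.complexConj L) (n' + n') (IsCMField.complexConj_ne_one L) (cmPlaceOver L) (cmPlaceOver_smul L) _
                (gramD_gram_realDiagonal_entry_ne_zero L e' dV hdV (tensorFrame L dW eW dV') (tensorFrame_real L dW hdW eW dV' hdV') hdV0 (tensorFrame_ne_zero L dW eW dV' hdW0 hdV'0)) (complexConj_imagUnit L) (imagUnit_ne_zero L) σ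
                (cmPlaceOver_comap L) (gramD_eq_diagonal_cm L e' dV hdV (tensorFrame L dW eW dV') (tensorFrame_real L dW hdW eW dV' hdV')) (J := hermD L e' dV hdV (tensorFrame L dW eW dV') (tensorFrame_real L dW hdW eW dV' hdV')) rfl
                (complexConj_smul_infinitePlace L) eP eQ ((toBig P Q R S (h, 1), (1 : UForm Unit Empty)) : Ginf ((P × R) ⊕ (Q × S)) ((P × S) ⊕ (Q × R)) Unit Empty))) :
    ∃ ℓ' : 𝓢(((DPIdx ((P × R) ⊕ (Q × S)) ((P × S) ⊕ (Q × R)) Unit Empty ⊕ (Fin (n' + n') × {v : {v : InfinitePlace (Fp L) // v.IsReal} // v ≠ σ})) → ℝ), ℂ) →L[ℂ] ℂ,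
      ∀ (h : UForm P Q) (Φ₁ : 𝓢((DPIdx P Q R S → ℝ), ℂ))
        (Φ₂ : 𝓢(((Fin (n' + n') × {v : {v : InfinitePlace (Fp L) // v.IsReal} // v ≠ σ}) → ℝ), ℂ))
        (a : 𝓢((Fin (n' + n') → mixedSpace (Fp L)), ℂ)),
        ((((schwartzTransport
                  (scaledFrame (Fp L) (Fin (n' + n'))
                    (placeScale (n' + n') fun v => sqrtAbs (signVec (cmPlaceOver L)
                      (fun k => Sum.elim (cmGramEntry L e' dV hdV (tensorFrame L dW eW dV') (tensorFrame_real L dW hdW eW dV' hdV')) (-cmGramEntry L e' dV hdV (tensorFrame L dW eW dV') (tensorFrame_real L dW hdW eW dV' hdV')) ((LocalSplitting.e₂ n').symm k))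
                      (imagUnit L) v))
                    (placeScale_ne_zero (n' + n') (sqrtAbs_signVec_ne_zero (IsCMField.complexConj_ne_one L) (cmPlaceOver_smul L)
                      (complexConj_imagUnit L) (imagUnit_ne_zero L) (gramD_gram_realDiagonal_entry_ne_zero L e' dV hdV (tensorFrame L dW eW dV') (tensorFrame_real L dW hdW eW dV' hdV') hdV0 (tensorFrame_ne_zero L dW eW dV' hdW0 hdV'0)))))).trans
                (schwartzTransport (reindexCLE (placeSplitEquiv (signSplit (signVec (cmPlaceOver L)
                  (fun k => Sum.elim (cmGramEntry L e' dV hdV (tensorFrame L dW eW dV') (tensorFrame_real L dW hdW eW dV' hdV')) (-cmGramEntry L e' dV hdV (tensorFrame L dW eW dV') (tensorFrame_real L dW hdW eW dV' hdV')) ((LocalSplitting.e₂ n').symm k))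
                  (imagUnit L) σ)) σ)))).trans
                (schwartzTransport (reindexCLE (Equiv.sumCongr
                  (unitJunctionIdx
                    (PosIdx (signVec (cmPlaceOver L)
                      (fun k => Sum.elim (cmGramEntry L e' dV hdV (tensorFrame L dW eW dV') (tensorFrame_real L dW hdW eW dV' hdV')) (-cmGramEntry L e' dV hdV (tensorFrame L dW eW dV') (tensorFrame_real L dW hdW eW dV' hdV')) ((LocalSplitting.e₂ n').symm k))
                      (imagUnit L) σ))
                    (NegIdx (signVec (cmPlaceOver L)
                      (fun k => Sum.elim (cmGramEntry L e' dV hdV (tensorFrame L dW eW dV') (tensorFrame_real L dW hdW eW dV' hdV')) (-cmGramEntry L e' dV hdV (tensorFrame L dW eW dV') (tensorFrame_real L dW hdW eW dV' hdV')) ((LocalSplitting.e₂ n').symm k))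
                      (imagUnit L) σ))).symm
                  (Equiv.refl (Fin (n' + n') × {v : {v : InfinitePlace (Fp L) // v.IsReal} // v ≠ σ})))))).trans
                (schwartzTransport (reindexCLE (Equiv.sumCongr
                  (dpIdxCongr
                    (PosIdx (signVec (cmPlaceOver L)
                      (fun k => Sum.elim (cmGramEntry L e' dV hdV (tensorFrame L dW eW dV') (tensorFrame_real L dW hdW eW dV' hdV')) (-cmGramEntry L e' dV hdV (tensorFrame L dW eW dV') (tensorFrame_real L dW hdW eW dV' hdV')) ((LocalSplitting.e₂ n').symm k))
                      (imagUnit L) σ))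
                    (NegIdx (signVec (cmPlaceOver L)
                      (fun k => Sum.elim (cmGramEntry L e' dV hdV (tensorFrame L dW eW dV') (tensorFrame_real L dW hdW eW dV' hdV')) (-cmGramEntry L e' dV hdV (tensorFrame L dW eW dV') (tensorFrame_real L dW hdW eW dV' hdV')) ((LocalSplitting.e₂ n').symm k))
                      (imagUnit L) σ))
                    Unit Empty ((P × R) ⊕ (Q × S)) ((P × S) ⊕ (Q × R)) Unit Empty eP eQ (Equiv.refl Unit) (Equiv.refl Empty)).symm
                  (Equiv.refl (Fin (n' + n') × {v : {v : InfinitePlace (Fp L) // v.IsReal} // v ≠ σ})))))) a = tensorPi ((schwartzTransport (reindexCLE (unitJunctionIdx ((P × R) ⊕ (Q × S)) ((P × S) ⊕ (Q × R))).symm)) Φ₁) Φ₂ →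
        swSectionTensor L e dV hdV dW hdW eW e' dV' hdV' hdV0 hdW0 hdV'0 sB (piSchwartzBruhatEquiv (Fp L) (Fin (n' + n')) (a ⊗ₜ f))
            (H * K2LiuArchOneParameterOrbitDefs.archEmb (Fp L) L (IsCMField.complexConj L) (n + n) (hermD L e dV hdV dW hdW) (ψ h)) =
          (((etaD L e' dV hdV (tensorFrame L dW eW dV') (tensorFrame_real L dW hdW eW dV' hdV') t
              (placeSecJ L (IsCMField.complexConj L) (n' + n') (IsCMField.complexConj_ne_one L) (cmPlaceOver L) (cmPlaceOver_smul L) _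
                (gramD_gram_realDiagonal_entry_ne_zero L e' dV hdV (tensorFrame L dW eW dV') (tensorFrame_real L dW hdW eW dV' hdV') hdV0 (tensorFrame_ne_zero L dW eW dV' hdW0 hdV'0)) (complexConj_imagUnit L) (imagUnit_ne_zero L) σ
                (cmPlaceOver_comap L) (gramD_eq_diagonal_cm L e' dV hdV (tensorFrame L dW eW dV') (tensorFrame_real L dW hdW eW dV' hdV')) (J := hermD L e' dV hdV (tensorFrame L dW eW dV') (tensorFrame_real L dW hdW eW dV' hdV')) rfl
                (complexConj_smul_infinitePlace L) eP eQ ((toBig P Q R S (h, 1), (1 : UForm Unit Empty)) : Ginf ((P × R) ⊕ (Q × S)) ((P × S) ⊕ (Q × R)) Unit Empty)) : ℂˣ) : ℂ)) *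
            ℓ' (tensorPi ((schwartzTransport (reindexCLE (unitJunctionIdx ((P × R) ⊕ (Q × S)) ((P × S) ⊕ (Q × R))).symm))
              ((weilRep (α := (P × R) ⊕ (Q × S)) (β := (P × S) ⊕ (Q × R))).comp (toBig P Q R S) ((h, (1 : UForm R S)) : Ginf P Q R S) Φ₁)) Φ₂) := by
  obtain ⟨ℓ', hℓ'⟩ := exists_clm_swSection_tmul_mul_archEmb_placeSecJ L e' dV hdV hdV0 (tensorFrame L dW eW dV') (tensorFrame_real L dW hdW eW dV' hdV')
    (tensorFrame_ne_zero L dW eW dV' hdW0 hdV'0) σ eP eQ hχu hχs hsB ht hodd (tensorEmb L e dV hdV dW hdW eW e' dV' hdV' H) f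
  refine ⟨ℓ', fun h Φ₁ Φ₂ a ha => ?_⟩
  -- `f^{V′}(H · k_h) = f_big((H ⊗ 1) · (k_h ⊗ 1)) = f_big((H ⊗ 1) · archEmb (placeSecJ_𝕎 σ (h ⊗ 1, 1)))` (★ `swSectionTensor_apply`, `map_mul`, `hsec`)
  have h1 : swSectionTensor L e dV hdV dW hdW eW e' dV' hdV' hdV0 hdW0 hdV'0 sB (piSchwartzBruhatEquiv (Fp L) (Fin (n' + n')) (a ⊗ₜ f))
        (H * K2LiuArchOneParameterOrbitDefs.archEmb (Fp L) L (IsCMField.complexConj L) (n + n) (hermD L e dV hdV dW hdW) (ψ h)) =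
      swSection L e' dV hdV hdV0 (tensorFrame L dW eW dV') (tensorFrame_real L dW hdW eW dV' hdV') (tensorFrame_ne_zero L dW eW dV' hdW0 hdV'0) sB
        (piSchwartzBruhatEquiv (Fp L) (Fin (n' + n')) (a ⊗ₜ f))
        (tensorEmb L e dV hdV dW hdW eW e' dV' hdV' H *
          K2LiuArchOneParameterOrbitDefs.archEmb (Fp L) L (IsCMField.complexConj L) (n' + n') (hermD L e' dV hdV (tensorFrame L dW eW dV') (tensorFrame_real L dW hdW eW dV' hdV'))
            (placeSecJ L (IsCMField.complexConj L) (n' + n') (IsCMField.complexConj_ne_one L) (cmPlaceOver L) (cmPlaceOver_smul L) _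
                (gramD_gram_realDiagonal_entry_ne_zero L e' dV hdV (tensorFrame L dW eW dV') (tensorFrame_real L dW hdW eW dV' hdV') hdV0 (tensorFrame_ne_zero L dW eW dV' hdW0 hdV'0)) (complexConj_imagUnit L) (imagUnit_ne_zero L) σ
                (cmPlaceOver_comap L) (gramD_eq_diagonal_cm L e' dV hdV (tensorFrame L dW eW dV') (tensorFrame_real L dW hdW eW dV' hdV')) (J := hermD L e' dV hdV (tensorFrame L dW eW dV') (tensorFrame_real L dW hdW eW dV' hdV')) rfl
                (complexConj_smul_infinitePlace L) eP eQ ((toBig P Q R S (h, 1), (1 : UForm Unit Empty)) : Ginf ((P × R) ⊕ (Q × S)) ((P × S) ⊕ (Q × R)) Unit Empty))) := by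
    rw [swSectionTensor_apply, map_mul, hsec]
  -- the (W4) CLM law at `u = (h ⊗ 1, 1)`, the pinned junction of `U(𝕎_σ) × U(1,0)`, and the see-saw
  have h2 := hℓ' ((toBig P Q R S (h, 1), (1 : UForm Unit Empty)) : Ginf ((P × R) ⊕ (Q × S)) ((P × S) ⊕ (Q × R)) Unit Empty) a
  rw [h1, h2, ha, archSectionRepJ_placeSecJ_inl_tensorPi, weilRepPair_unit_toBig_inl]

end Summit.HodgeConjecture.HodgeConjecture.Cruxes.HLiu418.K2LiuArchWeilJunctionTransport

end
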